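import Summits.ResolutionOfSingularities.ResolutionOfSingularities.Theorems.FrobeniusClosingSteerWords06SteeredVocab
import Summits.ResolutionOfSingularities.ResolutionOfSingularities.Theorems.FrobeniusClosingSteerSigmaTopLegalityOddDivisor

/-!
# Crux `Steer` (stmt-ResolutionOfSingularities-16345), chain W4.1, (Par-S) hARᵒ STAGE 2, legality slot (H3), σ_top half:
# «a PERMISSIBLE centre at a stage of a steered run FORCES a positive step of height ≥ 2 there» (res-type-062 g15; blueprint S5; Theses-free support)

OURS (campaign `res-hironaka`, rung L ★L-G4, slot W4.1; statements about the route's own objects — a σ_top-steered run `Words.IsSteeredRun O R P t p s`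
(`…Words06SteeredVocab`): at every stage the centre `P i` is a σ_top centre of `(R i, (s i)^p)`, i.e. a permissible positive-dimensional centre if one
exists, else the closed point; they replace the role of no printed item and are NOT statements of the manuscript under review
[claim: Hironaka2017, status: under-review]; AI review is weaker than expert review). Seat res-type-062 g15. Definition-free; no Theses file is imported.

## What is proved

* `isPermissibleCentre_iff` / `isSingPrime_iff` — the two VERBATIM copies of the σ_top words (`…Words06SteeredVocab` = the run's currency, and
  `…SigmaTopLegality` = res-D-pv-004's / res-D-pv-003's legality bricks) agree definitionally (`Iff.rfl`), so bricks concluding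
  `SigmaTopLegality.IsPermissibleCentre` feed the run.
* **`isPosStep_and_two_le_height_of_exists_isPermissibleCentre`** — σ_top MAXIMALITY read off `IsSteeredRun`: if at stage `i` SOME permissible centre
  exists, then the σ_top centre `P i` is itself permissible (the point-step disjunct of `IsSigmaTopCentre` requires that none exists), hence `P i ≠ 𝔪`
  (`IsPosStep R P i`) and — when the torsor has no singular prime of height `0` or `1` at that stage (generic torsor regular; no singular divisor: the
  run's N4 / `NormalAt` regime) — `2 ≤ (P i).height` (res-D-pv-004's (Fa) count `two_le_height_of_isSingPrime`, re-derived in the run's currency).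
  This is the step «legality ⇒ a height-≥2 step», contradicted on a late F-B tail by `¬ HeightTwoStepsInfinite` in the ARITH-REDUCTION
  (`ArithReduction.arithSwitchClause_of_bricks`, slot H3).

[cite: CossartJannsenSaito2009, Thm. 5.25] [folklore]
-/

-- `Summit.<S>.<S>.…` duplicates the summit name by design (single-problem summit).
set_option linter.dupNamespace false

open IsLocalRing

namespace Summit.ResolutionOfSingularities.ResolutionOfSingularities.Theorems.SwitchingDichotomy

namespace SigmaTopMaximality

open Summit.ResolutionOfSingularities.ResolutionOfSingularities.Theorems.SwitchingDichotomy.SigmaTopLegality (IsPointStep IsPosStep)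

variable {K : Type} [Field K]

/-! ## §1 The two copies of the σ_top words agree -/

/-- `SigmaTopLegality.IsSingPrime` (pv-004's copy) and `Words.IsSingPrime` (the run's copy) are the same proposition. [folklore] -/
theorem isSingPrime_iff (R : Subring K) (p : ℕ) (f : R) (Q : Ideal R) [Q.IsPrime] :
    SigmaTopLegality.IsSingPrime R p f Q ↔ Words.IsSingPrime R p f Q :=
  Iff.rfl

/-- `SigmaTopLegality.IsPermissibleCentre` and `Words.IsPermissibleCentre` are the same proposition. [folklore] -/
theorem isPermissibleCentre_iff (R : Subring K) [IsLocalRing R] (p : ℕ) (f : R) (P : Ideal R) :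
    SigmaTopLegality.IsPermissibleCentre R p f P ↔ Words.IsPermissibleCentre R p f P :=
  Iff.rfl

/-! ## §2 σ_top maximality: an available permissible centre forces a positive step of height ≥ 2 -/

section Run

variable {O : ValuationSubring K} {R : ℕ → Subring K} {P : (i : ℕ) → Ideal (R i)} {t : K} {p : ℕ} {s : ℕ → K}

/-- **σ_top takes an available permissible centre.** In a steered run, if at stage `i` some permissible centre exists (for the stage's radicand
`(s i)^p`, under the stage's local-ring structure), then the σ_top centre `P i` is permissible. [folklore] -/
theorem isPermissibleCentre_of_exists (hrun : Words.IsSteeredRun O R P t p s) (i : ℕ)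
    (hperm : ∀ (hloc : IsLocalRing (R i)) (hs : s i ^ p ∈ R i),
      ∃ Q : Ideal (R i), @Words.IsPermissibleCentre K _ (R i) hloc p ⟨s i ^ p, hs⟩ Q) :
    ∃ (hloc : IsLocalRing (R i)) (hs : s i ^ p ∈ R i), @Words.IsPermissibleCentre K _ (R i) hloc p ⟨s i ^ p, hs⟩ (P i) := by
  obtain ⟨hloc, hs, hσ, -, -⟩ := hrun.2 i
  refine ⟨hloc, hs, ?_⟩
  rcases hσ with hP | ⟨-, hnone, -⟩
  · exact hP
  · obtain ⟨Q, hQ⟩ := hperm hloc hs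
    exact absurd hQ (hnone Q)

/-- **σ_top maximality ⇒ a positive step of height ≥ 2.** In a steered run, if at stage `i` some permissible centre exists and the torsor
`T^p = (s i)^p` over `R i` has no singular prime of height `0` or `1`, then stage `i` is a POSITIVE step of height `≥ 2`. [folklore] -/
theorem isPosStep_and_two_le_height_of_exists_isPermissibleCentre (hrun : Words.IsSteeredRun O R P t p s) (i : ℕ)
    (hperm : ∀ (hloc : IsLocalRing (R i)) (hs : s i ^ p ∈ R i),
      ∃ Q : Ideal (R i), @Words.IsPermissibleCentre K _ (R i) hloc p ⟨s i ^ p, hs⟩ Q)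
    (h0 : ∀ (hs : s i ^ p ∈ R i) (Q : Ideal (R i)) [Q.IsPrime], Q.height = 0 → ¬ Words.IsSingPrime (R i) p ⟨s i ^ p, hs⟩ Q)
    (h1 : ∀ (hs : s i ^ p ∈ R i) (Q : Ideal (R i)) [Q.IsPrime], Q.height = 1 → ¬ Words.IsSingPrime (R i) p ⟨s i ^ p, hs⟩ Q) :
    IsPosStep R P i ∧ 2 ≤ (P i).height := by
  obtain ⟨hloc, hs, hP⟩ := isPermissibleCentre_of_exists hrun i hperm
  obtain ⟨hne, ⟨hprime, hsing, -, -⟩, -, -⟩ := hP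
  refine ⟨⟨hloc, hne⟩, ?_⟩
  haveI := hprime
  have hne0 : (P i).height ≠ 0 := fun h => h0 hs (P i) h hsing
  have hne1 : (P i).height ≠ 1 := fun h => h1 hs (P i) h hsing
  have hge1 : 1 ≤ (P i).height := Order.one_le_iff_ne_zero.mpr hne0
  have hgt1 : 1 < (P i).height := lt_of_le_of_ne hge1 (Ne.symm hne1)
  have := Order.add_one_le_of_lt hgt1
  rwa [one_add_one_eq_two] at this

/-- The same with the permissible centre given in res-D-pv-004's / res-D-pv-003's `SigmaTopLegality` currency (their bricks' conclusion). [folklore] -/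
theorem isPosStep_and_two_le_height_of_exists_isPermissibleCentre' (hrun : Words.IsSteeredRun O R P t p s) (i : ℕ)
    (hperm : ∀ (hloc : IsLocalRing (R i)) (hs : s i ^ p ∈ R i),
      ∃ Q : Ideal (R i), @SigmaTopLegality.IsPermissibleCentre K _ (R i) hloc p ⟨s i ^ p, hs⟩ Q)
    (h0 : ∀ (hs : s i ^ p ∈ R i) (Q : Ideal (R i)) [Q.IsPrime], Q.height = 0 →
      ¬ SigmaTopLegality.IsSingPrime (R i) p ⟨s i ^ p, hs⟩ Q)
    (h1 : ∀ (hs : s i ^ p ∈ R i) (Q : Ideal (R i)) [Q.IsPrime], Q.height = 1 →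
      ¬ SigmaTopLegality.IsSingPrime (R i) p ⟨s i ^ p, hs⟩ Q) :
    IsPosStep R P i ∧ 2 ≤ (P i).height :=
  isPosStep_and_two_le_height_of_exists_isPermissibleCentre hrun i hperm h0 h1

end Run

end SigmaTopMaximality

end Summit.ResolutionOfSingularities.ResolutionOfSingularities.Theorems.SwitchingDichotomy
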